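import Mathlib
import Literature.Computability.AlgebraicComplexity.LandsbergRessayreNormalForm

/-!
# A polynomial identity over `ℂ` holds over every field receiving `ℂ` (crux `BeyondHessianNs`)

Helper file for crux item stmt-ValiantsHypothesis-5641 (`RefutationDegree.BeyondHessianNs`),
stub `stub_identityTransfer` (plumbing step W3) of the line `Sketch`.

The normal-form pencil of size `ι × ι` over a commutative ring `R` in the variables `σ` is
`NF_R(Z) = Λ_{i₀} + Σ_{e ∈ σ} x_e Z_e ∈ (R[x_σ])^{ι × ι}` for `Z : σ → R^{ι × ι}`
(`Λ_{i₀} = lamMatrix R i₀ = diag(1, …, 0, …, 1)`).  A polynomial `Ψ` in the coefficient variables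
`X_μ` (`μ : σ →₀ ℕ`) with complex coefficients is evaluated at a polynomial `g ∈ K[x_σ]` over a
field `K` receiving `ℂ` via `φ : ℂ →+* K` as `eval₂ φ (fun μ => coeff μ g) Ψ`.

Claim (`stub_identityTransfer`): if `Ψ` vanishes at the coefficients of `det NF_ℂ(Z)` for every
complex `Z`, then it vanishes at the coefficients of `det NF_K(Z)` for every `Z` over `K`.

Proof (generic point).
* Naturality (`normalFormPencil_map`, `coeff_det_normalFormPencil`,
  `eval₂_coeff_det_normalFormPencil`): for a ring map `θ : R₁ →+* R₂` with `θ ∘ Z₁ = Z₂`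
  entrywise, `NF_{R₁}(Z₁).map (map θ) = NF_{R₂}(Z₂)`, hence (as `det`, `coeff` and `eval₂` commute
  with ring maps) `Ψ(coeff det NF_{R₂}(Z₂)) = θ (Ψ(coeff det NF_{R₁}(Z₁)))` when the structure maps
  are compatible (`θ.comp φ₁ = φ₂`).
* Generic vanishing (`eval₂_C_coeff_det_generic_eq_zero`): over `S = ℂ[z_{e,i,j}]` take the
  generic matrices `𝒵_e = (z_{e,i,j})_{i,j}`; the value `G = Ψ(coeff det NF_S(𝒵)) ∈ S` satisfies
  `eval z G = Ψ(coeff det NF_ℂ(𝒵(z))) = 0` for every complex point `z` (naturality along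
  `eval z : S → ℂ` and the hypothesis), so `G = 0` by `MvPolynomial.funext` (`ℂ` is infinite).
* Transfer: for `K`, `φ`, `Z`, naturality along `eval₂Hom φ Z : S →+* K` (which restricts to `φ`
  on `ℂ` and sends `𝒵` to `Z`) gives `Ψ(coeff det NF_K(Z)) = θ G = 0`.
-/

noncomputable section

-- single-conjunct layout: Sub = Summit, duplicated namespace component intended
set_option linter.dupNamespace false

namespace Summit.ValiantsHypothesis.ValiantsHypothesis.Theorems.RefutationDegreeBeyondHessianNs

open MvPolynomial Literature.Computability.AlgebraicComplexity

section Naturality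

variable {σ ι R₀ R₁ R₂ : Type*} [Fintype σ] [DecidableEq ι] [CommRing R₀] [CommRing R₁]
  [CommRing R₂]

/-- Naturality of the normal-form pencil `Λ_{i₀} + Σ_e x_e Z_e` in the coefficient ring: a ring
map `θ` applied coefficientwise to the entries of `NF_{R₁}(Z₁)` gives `NF_{R₂}(θ ∘ Z₁)`.
[folklore] -/
theorem normalFormPencil_map (θ : R₁ →+* R₂) (i₀ : ι) {Z₁ : σ → Matrix ι ι R₁}
    {Z₂ : σ → Matrix ι ι R₂} (hZ : ∀ e i j, θ (Z₁ e i j) = Z₂ e i j) :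
    ((lamMatrix R₁ i₀).map MvPolynomial.C +
        ∑ e : σ, (MvPolynomial.X e : MvPolynomial σ R₁) •
          (Z₁ e).map (MvPolynomial.C : R₁ →+* MvPolynomial σ R₁) :
          Matrix ι ι (MvPolynomial σ R₁)).map (MvPolynomial.map θ) =
      ((lamMatrix R₂ i₀).map MvPolynomial.C +
        ∑ e : σ, (MvPolynomial.X e : MvPolynomial σ R₂) •
          (Z₂ e).map (MvPolynomial.C : R₂ →+* MvPolynomial σ R₂) :
          Matrix ι ι (MvPolynomial σ R₂)) := by
  ext i j
  simp only [Matrix.map_apply, Matrix.add_apply, Matrix.sum_apply, Matrix.smul_apply,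
    lamMatrix_apply, map_add, map_sum, smul_eq_mul, map_mul, map_X, map_C, hZ]
  split_ifs <;> simp

variable [Fintype ι]

/-- Hence the coefficients of `det NF_{R₂}(θ ∘ Z₁)` are the images under `θ` of those of
`det NF_{R₁}(Z₁)` (`det` and `coeff` commute with ring maps). [folklore] -/
theorem coeff_det_normalFormPencil (θ : R₁ →+* R₂) (i₀ : ι) {Z₁ : σ → Matrix ι ι R₁}
    {Z₂ : σ → Matrix ι ι R₂} (hZ : ∀ e i j, θ (Z₁ e i j) = Z₂ e i j) (μ : σ →₀ ℕ) :
    MvPolynomial.coeff μ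
        ((lamMatrix R₂ i₀).map MvPolynomial.C +
          ∑ e : σ, (MvPolynomial.X e : MvPolynomial σ R₂) •
            (Z₂ e).map (MvPolynomial.C : R₂ →+* MvPolynomial σ R₂) :
            Matrix ι ι (MvPolynomial σ R₂)).det =
      θ (MvPolynomial.coeff μ
        ((lamMatrix R₁ i₀).map MvPolynomial.C +
          ∑ e : σ, (MvPolynomial.X e : MvPolynomial σ R₁) •
            (Z₁ e).map (MvPolynomial.C : R₁ →+* MvPolynomial σ R₁) :
            Matrix ι ι (MvPolynomial σ R₁)).det) := by
  rw [← normalFormPencil_map θ i₀ hZ, ← RingHom.mapMatrix_apply, ← RingHom.map_det, coeff_map]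

/-- Hence, for compatible structure maps `θ.comp φ₁ = φ₂`, evaluating a polynomial `Ψ` in the
coefficient variables at the coefficients of `det NF_{R₂}(θ ∘ Z₁)` (via `φ₂`) gives the image under
`θ` of its value at the coefficients of `det NF_{R₁}(Z₁)` (via `φ₁`). [folklore] -/
theorem eval₂_coeff_det_normalFormPencil (φ₁ : R₀ →+* R₁) (θ : R₁ →+* R₂) {φ₂ : R₀ →+* R₂}
    (hφ : θ.comp φ₁ = φ₂) (i₀ : ι) {Z₁ : σ → Matrix ι ι R₁} {Z₂ : σ → Matrix ι ι R₂}
    (hZ : ∀ e i j, θ (Z₁ e i j) = Z₂ e i j) (Ψ : MvPolynomial (σ →₀ ℕ) R₀) :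
    MvPolynomial.eval₂ φ₂ (fun μ => MvPolynomial.coeff μ
        ((lamMatrix R₂ i₀).map MvPolynomial.C +
          ∑ e : σ, (MvPolynomial.X e : MvPolynomial σ R₂) •
            (Z₂ e).map (MvPolynomial.C : R₂ →+* MvPolynomial σ R₂) :
            Matrix ι ι (MvPolynomial σ R₂)).det) Ψ =
      θ (MvPolynomial.eval₂ φ₁ (fun μ => MvPolynomial.coeff μ
        ((lamMatrix R₁ i₀).map MvPolynomial.C +
          ∑ e : σ, (MvPolynomial.X e : MvPolynomial σ R₁) •
            (Z₁ e).map (MvPolynomial.C : R₁ →+* MvPolynomial σ R₁) :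
            Matrix ι ι (MvPolynomial σ R₁)).det) Ψ) := by
  subst hφ
  rw [eval₂_comp_left]
  exact congrArg (fun g => MvPolynomial.eval₂ (θ.comp φ₁) g Ψ)
    (funext fun μ => coeff_det_normalFormPencil θ i₀ hZ μ)

end Naturality

/-- The ring of the generic point: `ℂ[z_{e,i,j}]`, `e : Fin n × Fin n`, `i j : Fin m`. -/
local notation3 "𝕊[" n ", " m "]" => MvPolynomial ((Fin n × Fin n) × (Fin m × Fin m)) ℂ

/-- **Generic vanishing.** If `Ψ` vanishes at the coefficients of `det NF_ℂ(Z)` for every complex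
`Z`, then it vanishes at the coefficients of `det NF_S(𝒵)` for the generic matrices
`𝒵_e = (z_{e,i,j})_{i,j}` over `S = ℂ[z_{e,i,j}]`: the value is a polynomial in the `z`'s all of
whose complex evaluations vanish (`MvPolynomial.funext`, `ℂ` infinite). [folklore] -/
theorem eval₂_C_coeff_det_generic_eq_zero {n m : ℕ} (i₀ : Fin m)
    (Ψ : MvPolynomial (Fin n × Fin n →₀ ℕ) ℂ)
    (hΨ : ∀ Z : Fin n × Fin n → Matrix (Fin m) (Fin m) ℂ,
      MvPolynomial.eval (fun μ => MvPolynomial.coeff μ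
        ((( Literature.Computability.AlgebraicComplexity.lamMatrix ℂ i₀).map MvPolynomial.C +
          ∑ e : Fin n × Fin n, (MvPolynomial.X e : MvPolynomial (Fin n × Fin n) ℂ) •
            (Z e).map (MvPolynomial.C : ℂ →+* MvPolynomial (Fin n × Fin n) ℂ) :
            Matrix (Fin m) (Fin m) (MvPolynomial (Fin n × Fin n) ℂ)).det)) Ψ = 0) :
    MvPolynomial.eval₂ (MvPolynomial.C : ℂ →+* 𝕊[n, m]) (fun μ => MvPolynomial.coeff μ
        (((lamMatrix 𝕊[n, m] i₀).map MvPolynomial.C +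
          ∑ e : Fin n × Fin n, (MvPolynomial.X e : MvPolynomial (Fin n × Fin n) 𝕊[n, m]) •
            (Matrix.of fun i j => (MvPolynomial.X (e, (i, j)) : 𝕊[n, m])).map
              (MvPolynomial.C : 𝕊[n, m] →+* MvPolynomial (Fin n × Fin n) 𝕊[n, m]) :
            Matrix (Fin m) (Fin m) (MvPolynomial (Fin n × Fin n) 𝕊[n, m])).det)) Ψ = 0 := by
  refine MvPolynomial.funext fun z => ?_
  rw [map_zero (MvPolynomial.eval z),
    ← eval₂_coeff_det_normalFormPencil MvPolynomial.C (MvPolynomial.eval z) (eval₂Hom_comp_C _ _) i₀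
      (Z₁ := fun e => Matrix.of fun i j => (MvPolynomial.X (e, (i, j)) : 𝕊[n, m]))
      (Z₂ := fun e => Matrix.of fun i j => z (e, (i, j))) (fun e i j => eval_X _) Ψ,
    eval₂_id]
  exact hΨ _

/-- **W3 — a polynomial identity over `ℂ` is an identity over every field receiving `ℂ`**: if `Ψ`
vanishes at the coefficients of `det(Λ_{i₀} + Σ_e X_e Z_e)` for all complex `Z`, then (over `K`, via
`φ : ℂ →+* K`) it vanishes at the coefficients of `det(Λ_{i₀} + Σ_e X_e Z_e)` for all `Z` over `K`
(stub `stub_identityTransfer` of the line `Sketch`).  Proof: naturality along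
`eval₂Hom φ Z : ℂ[z_{e,i,j}] →+* K` reduces to the generic vanishing
`eval₂_C_coeff_det_generic_eq_zero`. [folklore] -/
theorem stub_identityTransfer : ∀ (n m : ℕ) (i₀ : Fin m) (Ψ : MvPolynomial (Fin n × Fin n →₀ ℕ) ℂ),
    (∀ Z : Fin n × Fin n → Matrix (Fin m) (Fin m) ℂ,
      MvPolynomial.eval (fun μ => MvPolynomial.coeff μ
        ((( Literature.Computability.AlgebraicComplexity.lamMatrix ℂ i₀).map MvPolynomial.C +
          ∑ e : Fin n × Fin n, (MvPolynomial.X e : MvPolynomial (Fin n × Fin n) ℂ) •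
            (Z e).map (MvPolynomial.C : ℂ →+* MvPolynomial (Fin n × Fin n) ℂ) :
            Matrix (Fin m) (Fin m) (MvPolynomial (Fin n × Fin n) ℂ)).det)) Ψ = 0) →
    ∀ (K : Type) [Field K] (φ : ℂ →+* K) (Z : Fin n × Fin n → Matrix (Fin m) (Fin m) K),
      MvPolynomial.eval₂ φ (fun μ => MvPolynomial.coeff μ
        (((Literature.Computability.AlgebraicComplexity.lamMatrix K i₀).map MvPolynomial.C +
          ∑ e : Fin n × Fin n, (MvPolynomial.X e : MvPolynomial (Fin n × Fin n) K) •
            (Z e).map (MvPolynomial.C : K →+* MvPolynomial (Fin n × Fin n) K) :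
            Matrix (Fin m) (Fin m) (MvPolynomial (Fin n × Fin n) K)).det)) Ψ = 0 := by
  intro n m i₀ Ψ hΨ K _ φ Z
  have key := eval₂_coeff_det_normalFormPencil (σ := Fin n × Fin n) (ι := Fin m)
    (MvPolynomial.C : ℂ →+* 𝕊[n, m])
    (MvPolynomial.eval₂Hom φ fun v : (Fin n × Fin n) × (Fin m × Fin m) => Z v.1 v.2.1 v.2.2)
    (eval₂Hom_comp_C _ _) i₀
    (Z₁ := fun e => Matrix.of fun i j => (MvPolynomial.X (e, (i, j)) : 𝕊[n, m])) (Z₂ := Z)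
    (fun e i j => eval₂Hom_X' _ _ _) Ψ
  rw [key, eval₂_C_coeff_det_generic_eq_zero i₀ Ψ hΨ, map_zero]

end Summit.ValiantsHypothesis.ValiantsHypothesis.Theorems.RefutationDegreeBeyondHessianNs
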